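import Mathlib

/-!
# SoloBlind — the Koblitz–Ogus sum of a Beta vector is the CM-type indicator

For a level `N > 0` and any `u, a, b` (no coprimality needed), the (unnormalised)
Koblitz–Ogus sum of the Beta vector `β(a,b) = e_a + e_b - e_{a+b}` is
`⟨ua⟩ + ⟨ub⟩ - ⟨u(a+b)⟩ = N · (1 - 1_Φ(u))`, where `u ∈ Φ` (the CM type of the triple
`(a, b, -a-b)`) means `⟨ua⟩ + ⟨ub⟩ + ⟨u(-a-b)⟩ = N`, and `⟨u(-a-b)⟩ = N - ⟨u(a+b)⟩` when
`u(a+b) ≢ 0 (mod N)` (the identity below holds verbatim also in the degenerate case).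

Consequence used in `paper/weil-transport.md` §6 (vi)–(vii) (solo-blind programme): for a four-term
vector `v = β₁ + β₂ - β₃ - β₄` the Koblitz–Ogus condition `S_u(v) = 0 ∀u` is the Weil-type signature
condition `1_{Φ₁} + 1_{Φ₂} + 1_{Φ̄₃} + 1_{Φ̄₄} ≡ 2` for the cyclotomic field.
-/

namespace Summit.KontsevichZagierPeriods.KontsevichZagierPeriods.Theorems
namespace SoloBlind

/-- `⟨ua⟩ + ⟨ub⟩ - ⟨u(a+b)⟩` equals `0` when `u` lies in the CM type of `(a, b, -a-b)` and `N` otherwise. -/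
theorem koSum_betaVec (N u a b : ℕ) (hN : 0 < N) :
    ((u * a % N + u * b % N : ℕ) : ℤ) - (u * (a + b) % N : ℕ)
      = if u * a % N + u * b % N + (N - u * (a + b) % N) = N then (0 : ℤ) else (N : ℤ) := by
  have hxN : u * a % N < N := Nat.mod_lt _ hN
  have hyN : u * b % N < N := Nat.mod_lt _ hN
  have hzN : u * (a + b) % N < N := Nat.mod_lt _ hN
  have hmod : (u * a % N + u * b % N) % N = u * (a + b) % N := by
    rw [Nat.mul_add, Nat.add_mod (u * a) (u * b) N]
  generalize hx : u * a % N = x at *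
  generalize hy : u * b % N = y at *
  generalize hzz : u * (a + b) % N = z at *
  have hq : x + y = z + N * ((x + y) / N) := by
    have h := Nat.mod_add_div (x + y) N
    rw [hmod] at h
    omega
  have hql : (x + y) / N < 2 := by
    apply Nat.div_lt_of_lt_mul
    omega
  generalize hqdef : (x + y) / N = q at hq hql
  interval_cases q
  · have hsum : x + y + (N - z) = N := by omega
    rw [if_pos hsum]
    push_cast
    omega
  · have hne : x + y + (N - z) ≠ N := by omega
    rw [if_neg hne]
    push_cast
    omega

/-- The same statement with the CM-type indicator made explicit:
`S_u(β(a,b)) = N·(1 - [u ∈ Φ_{a,b}])`. -/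
theorem koSum_betaVec' (N u a b : ℕ) (hN : 0 < N) :
    ((u * a % N + u * b % N : ℕ) : ℤ) - (u * (a + b) % N : ℕ)
      = (N : ℤ) * (1 - (if u * a % N + u * b % N + (N - u * (a + b) % N) = N then (1 : ℤ) else 0)) := by
  rw [koSum_betaVec N u a b hN]
  split_ifs <;> ring

end SoloBlind
end Summit.KontsevichZagierPeriods.KontsevichZagierPeriods.Theorems
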